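import Summits.CriticalPhenomena.CardyFormulaZ2.Theorems.CardyFlipRussoCoveringLegStubFrameBridgeShift
import Summits.CriticalPhenomena.CardyFormulaZ2.Theorems.CardyFlipRussoCoveringLegStubRussoShift
import Summits.CriticalPhenomena.CardyFormulaZ2.Theorems.CardyFlipRussoCoveringLegStubCoveringBridgeShift
import HarnessLib

/-!
# `CardyFlipRusso.CoveringLeg` reduced to ONE typed conjecture (line `five-arm-null`, skeleton v3, after wave 2)

Route `CardyFlipRusso`, sub-problem `CriticalPhenomena/CardyFormulaZ2`, crux item stmt-CriticalPhenomena-6435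
(`Summit.CriticalPhenomena.CardyFormulaZ2.Theses.CardyFlipRusso.CoveringLeg`: Cardy for critical site percolation on
Beffara's centred square lattice `G_s`, crude discretisation, IMPLIES Cardy for critical bond percolation on `ℤ²`,
crude discretisation `embDomainCrossing`).  Lead `prover-line-stmt-CriticalPhenomena-6435-c1-0`, cycle 2.

With three of the four registered stubs of skeleton v3 landed — the exact frame bridge `stub_frameBridgeShift`
(p121289), Beffara's Prop. 18 + MVT per mesh `stub_russoShift` (p121401) and Kesten's covering bridge along the
shifted family `stub_coveringBridgeShift` (p121761, p122240; its analytic input is the tree's PROVED mesh-uniform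
crude-crossing continuity for bond-`ℤ²`, `stub_CrudeCrossingContinuity_of_SS` ∘ `SchrammSmirnov2011_lemma_5_1_holds`)
— this file records IN THE TREE what the crux now rests on (all three theorems below are CONDITIONAL proofs of the
crux by name; the gate records them as conditional results, nothing is claimed unconditionally):

* `coveringLeg_of_pivotalBalanceShift` — the crux follows from `PivotalBalanceShift`, Beffara's open eq. (5.1)
  (`sup_q |E_q N_II − E_q N_III| → 0`, Beffara 2008 §5.2: "the optimal statement … we were not able to conclude the
  proof") for the anchoring `R ⊕ δ·i/√2` of the lattice: THE ONE REMAINING REGISTERED STUB of the line;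
* `coveringLeg_of_pivotalBalanceUniform` — hence from the anchoring-uniform form `PivotalBalanceUniform`, which ALSO
  gives CardySectorGap's crux `VertexFacePivotalBalance` (stmt-7049) by name (`vertexFacePivotalBalance_of_uniform`,
  ShiftDefs p121158): the natural single item behind both routes' pivotal-balance cruxes;
* `coveringLeg_of_mixedInterpolationShift` — in fact only the INTEGRAL of Beffara's Russo integrand is consumed:
  `MixedInterpolationShift` (`P_{1/2}[cross] − P_0[cross] → 0` along the shifted family) suffices; and
* `mixedInterpolationShift_iff_universality` — that weakest sufficient input is, EXACTLY (frame bridge at `q = ½`,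
  covering bridge at `q = 0`), the frame-free crossing-universality statement
  `∀ R, siteProb (ρ⁻¹R) δ − bondProb R δ → 0` (`ρ⁻¹ = (1 + i)/√2`: the crude site-`G_s` crossing probability of the
  `+45°`-rotated rectangle and the crude bond-`ℤ²` crossing probability of `R` agree as `δ → 0⁺`), whence
  `coveringLeg_of_crossingUniversality`.

References: V. Beffara, *Is critical 2D percolation universal?*, Progr. Probab. 60 (2008) §5.1–5.2, Prop. 18,
eq. (5.1) [Beffara2008Universal]; H. Kesten, *Percolation theory for mathematicians* (1982) §3.4 [Kesten1982];
O. Schramm, S. Smirnov, Ann. Probab. 39 (2011) Lemma 5.1/6.1 [SchrammSmirnov2011].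
-/

noncomputable section

namespace Summit.CriticalPhenomena.CardyFormulaZ2.Cruxes.CoveringLeg.FiveArmNull

open Filter Set Topology
open Literature.Probability.RandomPlanarGeometry Literature.Probability.Percolation
open Literature.Probability.LatticeModels
open Literature.Barriers.CriticalPhenomena (MixedSite mixedParam)
open Summit.CriticalPhenomena.CardyFormulaZ2.Theses

/-! ### The crux modulo Beffara's eq. (5.1) -/

/-- **`CoveringLeg` ⟸ `PivotalBalanceShift`** (CONDITIONAL proof of the crux by name): skeleton v3 with its three
landed stubs; the hypothesis is Beffara's open eq. (5.1) for the shifted anchoring — the one remaining registered stub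
`stub_pivotalBalanceShift` of line five-arm-null. [cite: Beffara2008Universal, §5.2 eq. (5.1)] -/
theorem coveringLeg_of_pivotalBalanceShift : Summit.CriticalPhenomena.CardyFormulaZ2.Cruxes.CoveringLeg.FiveArmNull.PivotalBalanceShift → Summit.CriticalPhenomena.CardyFormulaZ2.Theses.CardyFlipRusso.CoveringLeg :=
  fun h => CoveringLeg_of_shiftStubs stub_frameBridgeShift h stub_russoShift stub_coveringBridgeShift

/-- **`CoveringLeg` ⟸ `PivotalBalanceUniform`** (CONDITIONAL): the anchoring-uniform form of eq. (5.1) closes this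
crux (via `pivotalBalanceShift_of_uniform`) and gives CardySectorGap's stmt-7049 by name
(`vertexFacePivotalBalance_of_uniform`). [cite: Beffara2008Universal, §5.2 eq. (5.1)] -/
theorem coveringLeg_of_pivotalBalanceUniform (hU : PivotalBalanceUniform) : CardyFlipRusso.CoveringLeg :=
  coveringLeg_of_pivotalBalanceShift (pivotalBalanceShift_of_uniform hU)

/-- **`CoveringLeg` ⟸ `MixedInterpolationShift`** (CONDITIONAL; the weakest input the composition consumes): only
the integral `P_{1/2}[cross] − P_0[cross] → 0` along the shifted family is used, not the uniform smallness of the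
Russo integrand. [cite: Beffara2008Universal, §5.2] -/
theorem coveringLeg_of_mixedInterpolationShift (hM : MixedInterpolationShift) : CardyFlipRusso.CoveringLeg :=
  coveringLeg_iff.2 fun hSite =>
    stub_coveringBridgeShift (mixedCardyZeroShift_of (stub_frameBridgeShift hSite) hM)

/-! ### The weakest sufficient input is frame-free crossing universality between the two lattices -/

/-- **`MixedInterpolationShift` unfolded to the two original models (exact).**  Along the shifted family the `q = ½`
crossing probability IS the crude site-`G_s` crossing probability `siteProb (ρ⁻¹R) δ` of the `+45°`-rotated rectangle
(`shift_lawP_half_crossS`, exact) and the `q = 0` crossing probability differs from the crude bond-`ℤ²` crossing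
probability `bondProb R δ` by `o(1)` (`coverShift_tendsto_sub`: Kesten's coupling, the collar sandwich and the tree's
crude-crossing continuity); hence `P_{1/2} − P_0 → 0` along the family iff `siteProb (ρ⁻¹R) δ − bondProb R δ → 0`.
[cite: Beffara2008Universal, §5.1–5.2] -/
theorem mixedInterpolationShift_iff_universality :
    MixedInterpolationShift ↔
      ∀ R : ConformalRectangle, Tendsto (fun δ : ℝ =>
        siteProb (R.map (similarity ((1 + Complex.I) / (Real.sqrt 2 : ℂ)) frame_rotInv_ne_zero 0)) δ -
          bondProb R δ) (𝓝[>] 0) (𝓝 0) := by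
  have hcov : ∀ R : ConformalRectangle, Tendsto (fun δ : ℝ =>
      (lawP 0).real (crossS (R.map (similarity 1 one_ne_zero ((δ : ℂ) * (Complex.I / (Real.sqrt 2 : ℂ))))) δ) -
        bondProb R δ) (𝓝[>] 0) (𝓝 0) :=
    fun R => coverShift_tendsto_sub cover_lowerCrossing_subset_crossS_shift R _
  constructor
  · intro hM R
    have h := (hM R).add (hcov R)
    simp only [shift_lawP_half_crossS, sub_add_sub_cancel, add_zero] at h
    exact h
  · intro hU R
    have h := (hU R).sub (hcov R)
    simp only [sub_zero] at h
    have key : (fun δ : ℝ =>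
        (lawP half).real (crossS (R.map (similarity 1 one_ne_zero ((δ : ℂ) * (Complex.I / (Real.sqrt 2 : ℂ))))) δ) -
          (lawP 0).real (crossS (R.map (similarity 1 one_ne_zero ((δ : ℂ) * (Complex.I / (Real.sqrt 2 : ℂ))))) δ)) =
        fun δ : ℝ =>
          (siteProb (R.map (similarity ((1 + Complex.I) / (Real.sqrt 2 : ℂ)) frame_rotInv_ne_zero 0)) δ -
              bondProb R δ) -
            ((lawP 0).real (crossS (R.map (similarity 1 one_ne_zero
                ((δ : ℂ) * (Complex.I / (Real.sqrt 2 : ℂ))))) δ) - bondProb R δ) := by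
      funext δ
      rw [shift_lawP_half_crossS]; ring
    rw [key]
    exact h

/-- **`CoveringLeg` ⟸ crossing universality between site-`G_s` and bond-`ℤ²`** (CONDITIONAL; frame-free form of the
line's one open input): if for every conformal rectangle the crude site-`G_s` crossing probability of the
`+45°`-rotated rectangle and the crude bond-`ℤ²` crossing probability of `R` agree asymptotically, then Cardy for
site-`G_s` implies Cardy for bond-`ℤ²` (both crude).  This is the content of the crux stripped of every bookkeeping
and boundary layer — all of which are now theorems of the tree. [cite: Beffara2008Universal, §5.1–5.2] -/
theorem coveringLeg_of_crossingUniversality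
    (hU : ∀ R : ConformalRectangle, Tendsto (fun δ : ℝ =>
      siteProb (R.map (similarity ((1 + Complex.I) / (Real.sqrt 2 : ℂ)) frame_rotInv_ne_zero 0)) δ -
        bondProb R δ) (𝓝[>] 0) (𝓝 0)) :
    CardyFlipRusso.CoveringLeg :=
  coveringLeg_of_mixedInterpolationShift (mixedInterpolationShift_iff_universality.2 hU)

end Summit.CriticalPhenomena.CardyFormulaZ2.Cruxes.CoveringLeg.FiveArmNull

end
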